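import Summits.QuantumFields.BalabanUV.T4Continuum.Support.NE3LiftDefectCorrection
import Summits.QuantumFields.BalabanUV.T4Continuum.Support.NE3FramePotBound
import HarnessLib

/-!
# NE7LevelMassBudget — THE WEIGHTED LEVEL-MASS SUM OF A HIERARCHICAL REPRESENTATIVE IN ROOT∕MINKOWSKI FORM:
# `X_i = r_i X_{i+1} + J_i` with BOUNDED COMPOSITE LIFTS ⇒ `Σ_{i≤m} L^{−3(m−i)}·‖X_i‖² ≤ 4C̄²L²·‖v‖² + 8C̄²·Σ_{k≤m} L^{−2(m−k)}·‖J_k‖²` — NO SHARP ONE-STEP CONSTANT NEEDED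
# (lineage `b2b-balaban-t4-ne7b-p1`, gen 162; route (H′) of memo `t4/b2b-balaban-t4-ne7b-p1/g162/records/SCOPING-LEVELMASSES.md` §8: the budget behind (G3))

Cell `pub-balaban`, rung (B)+1 sub-cell t4, lineage `b2b-balaban-t4-ne7b-p1` (row NE7b OWNER + CRUX PROVER; junction service for row NE7 on ROAD-G116 §6 (G3)), generation 162.
WHY.  ✓ p834121 `multiplierTerm_le_levelMasses` reduces the multiplier term of the bordered Hessian to the weighted level masses `Σ_{i≤m} K_maj·(L∕L⁴)^{m−i}·dirSq (dirIter i W ψ̃)`.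
Route (H′) builds the representative top-down, `X_{m+1} = v`, `X_i = r_i X_{i+1} + J_i` (`r_i` an exact one-step lift, `J_i` in row NE3's ONE-level slice).  Bounding `‖X_i‖²` by the
one-step recursion squares before summing and compounds the lift constant (`(1+θ)C_R < L` would be needed — false for every exact lift at `L = 2`, memo §8).  In ROOT form nothing
compounds: unrolled, `X_i = r_{i‥m} v + Σ_{k≥i} r_{i‥k−1} J_k`, Minkowski gives `‖X_i‖ ≤ ‖r_{i‥m}v‖ + Σ_k ‖r_{i‥k−1}J_k‖`, and only the COMPOSITE lifts `r_{i‥k−1} = r_i∘⋯∘r_{k−1}` need a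
letter `‖r_{i‥k−1}u‖ ≤ C̄·L^{k−i}·‖u‖` (the `(L^{k−i})^{(d−2)∕2}` of an interpolation-type lift in `d = 4`; `C̄` j-free of ANY size).  Cauchy–Schwarz on the Minkowski sum and two
geometric series then give the budget, whose right side is `mass(v)` plus the slice masses with the weights `L^{−2(m−k)}` — exactly what (P♮)_W at one level and the road's
curl-energy tower pay for (memo §8 (S), (E)).
WHAT ([folklore]; 0 def, 0 sorry):
§1 on a real vector space, one-step lifts `r_i` and COMPOSITE lifts `R i k` (any family with `R k k = id`, `r_i ∘ R (i+1) k = R i k` for `i < k` — e.g. `r_i ∘ ⋯ ∘ r_{k−1}`, or multi-step lifts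
   defined directly with this consistency): the UNROLLING `tower_unroll` of `X_i = r_i X_{i+1} + J_i` into `X_i = R i (m+1) v + Σ_{k∈[i,m]} R i k (J_k)`, and the abstract Minkowski bound
   **`seminorm_tower_le`** for any family `p_i` of subadditive functionals vanishing at `0`: `p_i(X_i) ≤ C̄·(ρ^{m+1−i}·p_{m+1}(v) + Σ_{k∈[i,m]} ρ^{k−i}·p_k(J_k))` from the composite
   letters on `v` and on the `J_k` ONLY;
§2 the real bookkeeping **`weighted_sq_sum_le`** (`L ≥ 2`): `a_i ≤ C̄(L^{m+1−i}A + Σ_{k∈[i,m]} L^{k−i}b_k)` (all nonnegative) ⇒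
   `Σ_{i≤m} (L³)⁻¹^{m−i}·a_i² ≤ 4C̄²L²·A² + 8C̄²·Σ_{k≤m} (L²)⁻¹^{m−k}·b_k²`;
§3 the tree's currency: `√dirSq` is subadditive (✓ `NE3LiftDefectCorrection.sqrt_dirSq_add_le`), and the headline **`levelMassBudget`**: for direction fields `X, J : ℕ → (Site d → Fin d → 𝕄)`,
   linear one-step lifts `r_i`, any boxes `F_i`, the tower identity and the composite letters in `√dirSq`,
   `Σ_{i≤m} (L³)⁻¹^{m−i}·dirSq (X i) (F i) ≤ 4C̄²L²·dirSq v (F (m+1)) + 8C̄²·Σ_{k≤m} (L²)⁻¹^{m−k}·dirSq (J k) (F k)`.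
WHAT IS NOT HERE: the lifts, the slices, the curl letters, (G3) — this is the budget they feed (memo §8).
HONEST FRAMING (page 1): linear∕real bookkeeping about OUR objects; nothing of Bałaban's asserted ([Balaban1985Averaging] (42), (110)–(125) context only); NOT (G3), NOT (G), NOT NE7∕NE3 as spine
nodes; row NE7b NOT PRINTED ∕ NOT PROVED; spine 0∕9; finite T⁴ rung (B)+1 — NOT infinite volume, NOT mass gap, NOT BetaPertH, NOT Clay.
-/

set_option autoImplicit false

open scoped BigOperators Matrix Matrix.Norms.L2Operator
open Finset

namespace Summit.QuantumFields.BalabanUV.T4Continuum.NE7LevelMassBudget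

open Literature.MathematicalPhysics.QuantumFieldTheory.Balaban1983to89
open B7Prop1Explicit
open T4AveragingDeficitWall (dirSq)
open NE3LiftDefectCorrection (sqrt_dirSq_add_le)

noncomputable section

/-! ## §1 The unrolled tower over composite lifts, the abstract Minkowski bound -/

section Abstract

variable {V : Type*} [AddCommGroup V] [Module ℝ V]

/-- **THE UNROLLED TOWER**: one-step lifts `r_i`, composite lifts `R i k` with `R k k = id` and `r_i ∘ R (i+1) k = R i k` (`i < k`); if `X (m+1) = v` and
`X i = r_i (X (i+1)) + J i` for `i ≤ m`, then for every `i ≤ m+1`, `X i = R i (m+1) v + Σ_{k ∈ [i, m]} R i k (J k)`. [folklore] -/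
theorem tower_unroll (r : ℕ → V →ₗ[ℝ] V) (R : ℕ → ℕ → V →ₗ[ℝ] V) (hRself : ∀ k, R k k = LinearMap.id)
    (hRleft : ∀ i k : ℕ, i < k → (r i).comp (R (i + 1) k) = R i k)
    (m : ℕ) (X J : ℕ → V) (v : V) (htop : X (m + 1) = v) (hX : ∀ i ≤ m, X i = r i (X (i + 1)) + J i) :
    ∀ i ≤ m + 1, X i = R i (m + 1) v + ∑ k ∈ Ico i (m + 1), R i k (J k) := by
  -- downward induction on `t = m + 1 - i`
  suffices h : ∀ t i : ℕ, i + t = m + 1 → X i = R i (m + 1) v + ∑ k ∈ Ico i (m + 1), R i k (J k) by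
    intro i hi
    exact h (m + 1 - i) i (by omega)
  intro t
  induction t with
  | zero =>
      intro i hi
      rw [add_zero] at hi
      subst hi
      rw [hRself, Finset.Ico_self, Finset.sum_empty, add_zero, LinearMap.id_apply, htop]
  | succ t ih =>
      intro i hi
      have him : i ≤ m := by omega
      have h1 := ih (i + 1) (by omega)
      rw [hX i him, h1, map_add, map_sum, Finset.sum_eq_sum_Ico_succ_bot (show i < m + 1 by omega), hRself,
        LinearMap.id_apply]
      have hv : (r i) ((R (i + 1) (m + 1)) v) = R i (m + 1) v := by
        rw [← LinearMap.comp_apply, hRleft i (m + 1) (by omega)]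
      have hJ : ∀ k ∈ Ico (i + 1) (m + 1), (r i) ((R (i + 1) k) (J k)) = R i k (J k) := by
        intro k hk
        rw [← LinearMap.comp_apply, hRleft i k (by have := (Finset.mem_Ico.mp hk).1; omega)]
      rw [hv, Finset.sum_congr rfl hJ]
      abel

omit [Module ℝ V] in
/-- Finite subadditivity of a functional that is subadditive and vanishes at `0`. [folklore] -/
theorem subadd_sum_le (p : V → ℝ) (hp0 : p 0 = 0) (hp : ∀ a b : V, p (a + b) ≤ p a + p b) {ι : Type*} (s : Finset ι) (f : ι → V) :
    p (∑ k ∈ s, f k) ≤ ∑ k ∈ s, p (f k) := by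
  classical
  induction s using Finset.induction_on with
  | empty => simp [hp0]
  | insert a s ha ih =>
      rw [Finset.sum_insert ha, Finset.sum_insert ha]
      exact (hp _ _).trans (by linarith)

/-- **THE ABSTRACT MINKOWSKI BOUND OF THE TOWER.**  `p : ℕ → V → ℝ` a family of subadditive functionals vanishing at `0` (level seminorms); tower as in `tower_unroll`;
COMPOSITE letters on the data actually lifted: `p_i (R i (m+1) v) ≤ C̄·ρ^{m+1−i}·p_{m+1} v` (`i ≤ m+1`) and `p_i (R i k (J k)) ≤ C̄·ρ^{k−i}·p_k (J k)` (`i ≤ k ≤ m`).  Then for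
every `i ≤ m+1`: `p_i (X i) ≤ C̄·(ρ^{m+1−i}·p_{m+1} v + Σ_{k∈[i,m]} ρ^{k−i}·p_k (J k))`. [folklore] -/
theorem seminorm_tower_le (p : ℕ → V → ℝ) (hp0 : ∀ i, p i 0 = 0) (hp : ∀ i (a b : V), p i (a + b) ≤ p i a + p i b)
    (r : ℕ → V →ₗ[ℝ] V) (R : ℕ → ℕ → V →ₗ[ℝ] V) (hRself : ∀ k, R k k = LinearMap.id)
    (hRleft : ∀ i k : ℕ, i < k → (r i).comp (R (i + 1) k) = R i k)
    (m : ℕ) (X J : ℕ → V) (v : V) (htop : X (m + 1) = v) (hX : ∀ i ≤ m, X i = r i (X (i + 1)) + J i)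
    {Cb ρ : ℝ} (hv : ∀ i ≤ m + 1, p i (R i (m + 1) v) ≤ Cb * ρ ^ (m + 1 - i) * p (m + 1) v)
    (hJ : ∀ i k : ℕ, i ≤ k → k ≤ m → p i (R i k (J k)) ≤ Cb * ρ ^ (k - i) * p k (J k)) :
    ∀ i ≤ m + 1, p i (X i) ≤ Cb * (ρ ^ (m + 1 - i) * p (m + 1) v + ∑ k ∈ Ico i (m + 1), ρ ^ (k - i) * p k (J k)) := by
  intro i hi
  rw [tower_unroll r R hRself hRleft m X J v htop hX i hi]
  refine (hp i _ _).trans ?_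
  have h2 : p i (∑ k ∈ Ico i (m + 1), R i k (J k)) ≤ ∑ k ∈ Ico i (m + 1), Cb * ρ ^ (k - i) * p k (J k) :=
    (subadd_sum_le (p i) (hp0 i) (hp i) _ _).trans
      (Finset.sum_le_sum fun k hk => hJ i k (Finset.mem_Ico.mp hk).1 (by have := (Finset.mem_Ico.mp hk).2; omega))
  have h1 := hv i hi
  rw [mul_add, Finset.mul_sum]
  exact add_le_add (h1.trans (le_of_eq (by ring))) (h2.trans (le_of_eq (Finset.sum_congr rfl fun k _ => by ring)))

end Abstract

/-! ## §2 The real bookkeeping: Cauchy–Schwarz on the Minkowski sum and two geometric series -/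

/-- `Σ_{k∈[i,n)} L^{k−i} ≤ 2·L^{n−1−i}` for `L ≥ 2`, `i < n`. [folklore] -/
theorem geom_Ico_le {L : ℝ} (hL : 2 ≤ L) {i n : ℕ} (hin : i < n) :
    ∑ k ∈ Ico i n, L ^ (k - i) ≤ 2 * L ^ (n - 1 - i) := by
  have hL0 : 0 < L := by linarith
  obtain ⟨t, rfl⟩ : ∃ t, n = i + t + 1 := ⟨n - i - 1, by omega⟩
  rw [Finset.sum_Ico_eq_sum_range]
  have e1 : i + t + 1 - i = t + 1 := by omega
  have e2 : i + t + 1 - 1 - i = t := by omega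
  rw [e1, e2, Finset.sum_congr rfl fun k _ => by rw [Nat.add_sub_cancel_left]]
  -- `Σ_{k<t+1} L^k = L^t · Σ_{k<t+1} (L⁻¹)^{t-k} ≤ L^t · 2`
  have hrefl : ∑ k ∈ range (t + 1), L ^ k = L ^ t * ∑ k ∈ range (t + 1), (L⁻¹) ^ k := by
    rw [Finset.mul_sum]
    have h := Finset.sum_range_reflect (fun k => L ^ k) (t + 1)
    rw [← h]
    refine Finset.sum_congr rfl fun k hk => ?_
    have hk' : k ≤ t := by have := Finset.mem_range.mp hk; omega
    simp only [add_tsub_cancel_right]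
    rw [inv_pow, ← div_eq_mul_inv, eq_div_iff (pow_ne_zero _ hL0.ne'), ← pow_add, Nat.sub_add_cancel hk']
  rw [hrefl, mul_comm]
  refine mul_le_mul_of_nonneg_right ?_ (pow_nonneg hL0.le _)
  have hg := NE3FramePotBound.geom_sum_le_inv (q := L⁻¹) (by positivity) (by rw [inv_lt_one₀ hL0]; linarith) (t + 1)
  refine hg.trans ?_
  rw [div_le_iff₀ (by rw [sub_pos, inv_lt_one₀ hL0]; linarith)]
  have : L⁻¹ ≤ 1 / 2 := by rw [inv_le_comm₀ hL0 (by norm_num)]; linarith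
  linarith

/-- `Σ_{k<n} (L⁻¹)^k ≤ 2` for `L ≥ 2`. [folklore] -/
theorem geom_inv_le_two {L : ℝ} (hL : 2 ≤ L) (n : ℕ) : ∑ k ∈ range n, (L⁻¹) ^ k ≤ 2 := by
  have hL0 : 0 < L := by linarith
  have hg := NE3FramePotBound.geom_sum_le_inv (q := L⁻¹) (by positivity) (by rw [inv_lt_one₀ hL0]; linarith) n
  refine hg.trans ?_
  rw [div_le_iff₀ (by rw [sub_pos, inv_lt_one₀ hL0]; linarith)]
  have : L⁻¹ ≤ 1 / 2 := by rw [inv_le_comm₀ hL0 (by norm_num)]; linarith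
  linarith

/-- **THE WEIGHTED SQUARE SUM** (`L ≥ 2`; `C̄, A, b_k ≥ 0`): if `0 ≤ a_i ≤ C̄·(L^{m+1−i}·A + Σ_{k∈[i,m]} L^{k−i}·b_k)` for every `i ≤ m`, then
`Σ_{i≤m} (L³)⁻¹^{m−i}·a_i² ≤ 4C̄²L²·A² + 8C̄²·Σ_{k≤m} (L²)⁻¹^{m−k}·b_k²`. [folklore] -/
theorem weighted_sq_sum_le {L : ℝ} (hL : 2 ≤ L) (m : ℕ) {Cb A : ℝ} (hCb : 0 ≤ Cb) (hA : 0 ≤ A) {a b : ℕ → ℝ}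
    (ha0 : ∀ i ≤ m, 0 ≤ a i) (hb0 : ∀ k ≤ m, 0 ≤ b k)
    (ha : ∀ i ≤ m, a i ≤ Cb * (L ^ (m + 1 - i) * A + ∑ k ∈ Ico i (m + 1), L ^ (k - i) * b k)) :
    ∑ i ∈ range (m + 1), (L ^ 3)⁻¹ ^ (m - i) * a i ^ 2
      ≤ 4 * Cb ^ 2 * L ^ 2 * A ^ 2 + 8 * Cb ^ 2 * ∑ k ∈ range (m + 1), (L ^ 2)⁻¹ ^ (m - k) * b k ^ 2 := by
  have hL0 : 0 < L := by linarith
  have hL1 : (1 : ℝ) ≤ L := by linarith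
  -- Step 1: square and split each `a_i`
  have hsq : ∀ i ∈ range (m + 1), (L ^ 3)⁻¹ ^ (m - i) * a i ^ 2
      ≤ 2 * Cb ^ 2 * A ^ 2 * (L ^ 2 * (L⁻¹) ^ (m - i))
        + 4 * Cb ^ 2 * ∑ k ∈ Ico i (m + 1), ((L ^ 2)⁻¹ ^ (m - k) * (L⁻¹) ^ (k - i)) * b k ^ 2 := by
    intro i hi
    have him : i ≤ m := by have := Finset.mem_range.mp hi; omega
    set S : ℝ := ∑ k ∈ Ico i (m + 1), L ^ (k - i) * b k with hS
    have hS0 : 0 ≤ S := Finset.sum_nonneg fun k hk => mul_nonneg (pow_nonneg hL0.le _) (hb0 k (by have := (Finset.mem_Ico.mp hk).2; omega))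
    have hP0 : 0 ≤ L ^ (m + 1 - i) * A := mul_nonneg (pow_nonneg hL0.le _) hA
    -- `a_i² ≤ 2C̄²(L^{2(m+1-i)}A² + S²)`
    have h1 : a i ^ 2 ≤ 2 * Cb ^ 2 * ((L ^ (m + 1 - i) * A) ^ 2 + S ^ 2) := by
      have h := ha i him
      have h0 := ha0 i him
      have hR0 : 0 ≤ Cb * (L ^ (m + 1 - i) * A + S) := mul_nonneg hCb (add_nonneg hP0 hS0)
      calc a i ^ 2 ≤ (Cb * (L ^ (m + 1 - i) * A + S)) ^ 2 := pow_le_pow_left₀ h0 h 2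
        _ = Cb ^ 2 * (L ^ (m + 1 - i) * A + S) ^ 2 := by ring
        _ ≤ Cb ^ 2 * (2 * ((L ^ (m + 1 - i) * A) ^ 2 + S ^ 2)) :=
            mul_le_mul_of_nonneg_left (by nlinarith [sq_nonneg (L ^ (m + 1 - i) * A - S)]) (sq_nonneg _)
        _ = _ := by ring
    -- Cauchy–Schwarz: `S² ≤ (Σ L^{k-i}) (Σ L^{k-i} b_k²) ≤ 2L^{m-i} Σ L^{k-i} b_k²`
    have hCS : S ^ 2 ≤ 2 * L ^ (m - i) * ∑ k ∈ Ico i (m + 1), L ^ (k - i) * b k ^ 2 := by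
      have h := Finset.sum_mul_sq_le_sq_mul_sq (Ico i (m + 1)) (fun k => Real.sqrt (L ^ (k - i))) (fun k => Real.sqrt (L ^ (k - i)) * b k)
      have e1 : ∀ k ∈ Ico i (m + 1), Real.sqrt (L ^ (k - i)) * (Real.sqrt (L ^ (k - i)) * b k) = L ^ (k - i) * b k := by
        intro k _
        rw [← mul_assoc, Real.mul_self_sqrt (pow_nonneg hL0.le _)]
      have e2 : ∀ k ∈ Ico i (m + 1), Real.sqrt (L ^ (k - i)) ^ 2 = L ^ (k - i) := fun k _ => Real.sq_sqrt (pow_nonneg hL0.le _)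
      have e3 : ∀ k ∈ Ico i (m + 1), (Real.sqrt (L ^ (k - i)) * b k) ^ 2 = L ^ (k - i) * b k ^ 2 := by
        intro k _
        rw [mul_pow, Real.sq_sqrt (pow_nonneg hL0.le _)]
      rw [Finset.sum_congr rfl e1, Finset.sum_congr rfl e2, Finset.sum_congr rfl e3, ← hS] at h
      have hg := geom_Ico_le hL (show i < m + 1 by omega)
      rw [show m + 1 - 1 - i = m - i by omega] at hg
      have hT0 : 0 ≤ ∑ k ∈ Ico i (m + 1), L ^ (k - i) * b k ^ 2 := Finset.sum_nonneg fun k _ => mul_nonneg (pow_nonneg hL0.le _) (sq_nonneg _)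
      exact h.trans (mul_le_mul_of_nonneg_right hg hT0)
    -- the weights: `(L³)⁻¹^{m-i}·L^{2(m+1-i)} = L²·(L⁻¹)^{m-i}` and `(L³)⁻¹^{m-i}·L^{m-i}·L^{k-i} = (L²)⁻¹^{m-k}·(L⁻¹)^{k-i}`
    obtain ⟨t, rfl⟩ : ∃ t, m = i + t := ⟨m - i, by omega⟩
    have et : i + t - i = t := by omega
    have hw1 : (L ^ 3)⁻¹ ^ (i + t - i) * (L ^ (i + t + 1 - i) * A) ^ 2 = A ^ 2 * (L ^ 2 * (L⁻¹) ^ (i + t - i)) := by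
      rw [et, show i + t + 1 - i = t + 1 by omega]
      have : (L ^ 3)⁻¹ ^ t * (L ^ (t + 1)) ^ 2 = L ^ 2 * (L⁻¹) ^ t := by
        rw [inv_pow, inv_pow, ← pow_mul, ← pow_mul]
        field_simp
        ring
      calc (L ^ 3)⁻¹ ^ t * (L ^ (t + 1) * A) ^ 2 = ((L ^ 3)⁻¹ ^ t * (L ^ (t + 1)) ^ 2) * A ^ 2 := by ring
        _ = _ := by rw [this]; ring
    have hw2 : ∀ k ∈ Ico i (i + t + 1), (L ^ 3)⁻¹ ^ (i + t - i) * L ^ (i + t - i) * (L ^ (k - i) * b k ^ 2)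
        = ((L ^ 2)⁻¹ ^ (i + t - k) * (L⁻¹) ^ (k - i)) * b k ^ 2 := by
      intro k hk
      obtain ⟨hk1, hk2⟩ := Finset.mem_Ico.mp hk
      obtain ⟨s, rfl⟩ : ∃ s, k = i + s := ⟨k - i, by omega⟩
      have hs : s ≤ t := by omega
      obtain ⟨u, rfl⟩ : ∃ u, t = s + u := ⟨t - s, by omega⟩
      rw [show i + (s + u) - i = s + u by omega, show i + s - i = s by omega, show i + (s + u) - (i + s) = u by omega]
      have : (L ^ 3)⁻¹ ^ (s + u) * L ^ (s + u) * L ^ s = (L ^ 2)⁻¹ ^ u * (L⁻¹) ^ s := by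
        rw [inv_pow, inv_pow, inv_pow, ← pow_mul, ← pow_mul]
        field_simp
        ring
      calc (L ^ 3)⁻¹ ^ (s + u) * L ^ (s + u) * (L ^ s * b (i + s) ^ 2)
          = ((L ^ 3)⁻¹ ^ (s + u) * L ^ (s + u) * L ^ s) * b (i + s) ^ 2 := by ring
        _ = _ := by rw [this]
    have hW0 : 0 ≤ (L ^ 3)⁻¹ ^ (i + t - i) := pow_nonneg (by positivity) _
    calc (L ^ 3)⁻¹ ^ (i + t - i) * a i ^ 2
        ≤ (L ^ 3)⁻¹ ^ (i + t - i) * (2 * Cb ^ 2 * ((L ^ (i + t + 1 - i) * A) ^ 2 + S ^ 2)) := mul_le_mul_of_nonneg_left h1 hW0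
      _ ≤ (L ^ 3)⁻¹ ^ (i + t - i) * (2 * Cb ^ 2 * ((L ^ (i + t + 1 - i) * A) ^ 2
            + 2 * L ^ (i + t - i) * ∑ k ∈ Ico i (i + t + 1), L ^ (k - i) * b k ^ 2)) := by
          refine mul_le_mul_of_nonneg_left (mul_le_mul_of_nonneg_left (add_le_add le_rfl hCS) (by positivity)) hW0
      _ = 2 * Cb ^ 2 * ((L ^ 3)⁻¹ ^ (i + t - i) * (L ^ (i + t + 1 - i) * A) ^ 2)
            + 4 * Cb ^ 2 * (((L ^ 3)⁻¹ ^ (i + t - i) * L ^ (i + t - i)) * ∑ k ∈ Ico i (i + t + 1), L ^ (k - i) * b k ^ 2) := by ring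
      _ = 2 * Cb ^ 2 * A ^ 2 * (L ^ 2 * (L⁻¹) ^ (i + t - i))
            + 4 * Cb ^ 2 * ∑ k ∈ Ico i (i + t + 1), ((L ^ 2)⁻¹ ^ (i + t - k) * (L⁻¹) ^ (k - i)) * b k ^ 2 := by
          rw [hw1, Finset.mul_sum, Finset.sum_congr rfl fun k hk => by rw [hw2 k hk]]
          ring
  -- Step 2: sum over `i`, first term: `Σ_i L²(L⁻¹)^{m-i} ≤ 2L²`
  have hT1 : ∑ i ∈ range (m + 1), 2 * Cb ^ 2 * A ^ 2 * (L ^ 2 * (L⁻¹) ^ (m - i)) ≤ 4 * Cb ^ 2 * L ^ 2 * A ^ 2 := by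
    rw [← Finset.mul_sum, ← Finset.mul_sum]
    have hrefl : ∑ i ∈ range (m + 1), (L⁻¹) ^ (m - i) = ∑ i ∈ range (m + 1), (L⁻¹) ^ i := by
      have h := Finset.sum_range_reflect (fun k => (L⁻¹) ^ k) (m + 1)
      simpa using h
    rw [hrefl]
    have hg := geom_inv_le_two hL (m + 1)
    have h0 : 0 ≤ 2 * Cb ^ 2 * A ^ 2 * L ^ 2 := by positivity
    calc 2 * Cb ^ 2 * A ^ 2 * (L ^ 2 * ∑ i ∈ range (m + 1), (L⁻¹) ^ i) = (2 * Cb ^ 2 * A ^ 2 * L ^ 2) * ∑ i ∈ range (m + 1), (L⁻¹) ^ i := by ring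
      _ ≤ (2 * Cb ^ 2 * A ^ 2 * L ^ 2) * 2 := mul_le_mul_of_nonneg_left hg h0
      _ = _ := by ring
  -- second term: exchange the sums, `Σ_{i≤k} (L⁻¹)^{k-i} ≤ 2`
  have hT2 : ∑ i ∈ range (m + 1), 4 * Cb ^ 2 * ∑ k ∈ Ico i (m + 1), ((L ^ 2)⁻¹ ^ (m - k) * (L⁻¹) ^ (k - i)) * b k ^ 2
      ≤ 8 * Cb ^ 2 * ∑ k ∈ range (m + 1), (L ^ 2)⁻¹ ^ (m - k) * b k ^ 2 := by
    rw [← Finset.mul_sum]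
    have hex : ∑ i ∈ range (m + 1), ∑ k ∈ Ico i (m + 1), ((L ^ 2)⁻¹ ^ (m - k) * (L⁻¹) ^ (k - i)) * b k ^ 2
        = ∑ k ∈ range (m + 1), ∑ i ∈ range (k + 1), ((L ^ 2)⁻¹ ^ (m - k) * (L⁻¹) ^ (k - i)) * b k ^ 2 := by
      refine Finset.sum_comm' fun i k => ?_
      simp only [Finset.mem_range, Finset.mem_Ico]
      omega
    rw [hex]
    have hinner : ∀ k ∈ range (m + 1), ∑ i ∈ range (k + 1), ((L ^ 2)⁻¹ ^ (m - k) * (L⁻¹) ^ (k - i)) * b k ^ 2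
        ≤ 2 * ((L ^ 2)⁻¹ ^ (m - k) * b k ^ 2) := by
      intro k _
      have e : ∑ i ∈ range (k + 1), ((L ^ 2)⁻¹ ^ (m - k) * (L⁻¹) ^ (k - i)) * b k ^ 2
          = ((L ^ 2)⁻¹ ^ (m - k) * b k ^ 2) * ∑ i ∈ range (k + 1), (L⁻¹) ^ (k - i) := by
        rw [Finset.mul_sum]; refine Finset.sum_congr rfl fun i _ => by ring
      rw [e]
      have hrefl : ∑ i ∈ range (k + 1), (L⁻¹) ^ (k - i) = ∑ i ∈ range (k + 1), (L⁻¹) ^ i := by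
        have h := Finset.sum_range_reflect (fun j => (L⁻¹) ^ j) (k + 1)
        simpa using h
      rw [hrefl, mul_comm]
      exact mul_le_mul_of_nonneg_right (geom_inv_le_two hL (k + 1)) (by positivity)
    calc 4 * Cb ^ 2 * ∑ k ∈ range (m + 1), ∑ i ∈ range (k + 1), ((L ^ 2)⁻¹ ^ (m - k) * (L⁻¹) ^ (k - i)) * b k ^ 2
        ≤ 4 * Cb ^ 2 * ∑ k ∈ range (m + 1), 2 * ((L ^ 2)⁻¹ ^ (m - k) * b k ^ 2) :=
          mul_le_mul_of_nonneg_left (Finset.sum_le_sum hinner) (by positivity)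
      _ = _ := by rw [← Finset.mul_sum]; ring
  calc ∑ i ∈ range (m + 1), (L ^ 3)⁻¹ ^ (m - i) * a i ^ 2
      ≤ ∑ i ∈ range (m + 1), (2 * Cb ^ 2 * A ^ 2 * (L ^ 2 * (L⁻¹) ^ (m - i))
          + 4 * Cb ^ 2 * ∑ k ∈ Ico i (m + 1), ((L ^ 2)⁻¹ ^ (m - k) * (L⁻¹) ^ (k - i)) * b k ^ 2) := Finset.sum_le_sum hsq
    _ ≤ _ := by rw [Finset.sum_add_distrib]; exact add_le_add hT1 hT2

/-! ## §3 The tree's currency: `√dirSq` on level boxes, and the headline -/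

variable {d : ℕ} {n : Type*} [Fintype n] [DecidableEq n]

/-- `dirSq 0 F = 0`. [folklore] -/
theorem dirSq_zero (F : Finset (Site d)) : dirSq (fun (_ : Site d) (_ : Fin d) => (0 : Matrix n n ℂ)) F = 0 := by
  unfold dirSq; simp [norm_zero]

/-- **THE LEVEL-MASS BUDGET OF A HIERARCHICAL REPRESENTATIVE** (`L ≥ 2`, `C̄ ≥ 0`).  Data: direction fields `X, J : ℕ → (Site d → Fin d → 𝕄)` and `v` with the tower identity
`X (m+1) = v`, `X i = r_i (X (i+1)) + J i` (`i ≤ m`) for ℝ-linear one-step lifts `r_i` with composite lifts `R i k` (`R k k = id`, `r_i ∘ R (i+1) k = R i k` for `i < k`); level boxes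
`F_i`; COMPOSITE letters in root form on the data actually lifted: `√dirSq (R i (m+1) v) (F i) ≤ C̄·L^{m+1−i}·√dirSq v (F (m+1))` (`i ≤ m+1`) and
`√dirSq (R i k (J k)) (F i) ≤ C̄·L^{k−i}·√dirSq (J k) (F k)` (`i ≤ k ≤ m`).  Then
`Σ_{i≤m} (L³)⁻¹^{m−i}·dirSq (X i) (F i) ≤ 4C̄²L²·dirSq v (F (m+1)) + 8C̄²·Σ_{k≤m} (L²)⁻¹^{m−k}·dirSq (J k) (F k)`. [folklore] -/
theorem levelMassBudget {L : ℕ} (hL : 2 ≤ L) (m : ℕ) (F : ℕ → Finset (Site d))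
    (r : ℕ → (Site d → Fin d → Matrix n n ℂ) →ₗ[ℝ] (Site d → Fin d → Matrix n n ℂ))
    (R : ℕ → ℕ → (Site d → Fin d → Matrix n n ℂ) →ₗ[ℝ] (Site d → Fin d → Matrix n n ℂ))
    (hRself : ∀ k, R k k = LinearMap.id) (hRleft : ∀ i k : ℕ, i < k → (r i).comp (R (i + 1) k) = R i k)
    (X J : ℕ → Site d → Fin d → Matrix n n ℂ) (v : Site d → Fin d → Matrix n n ℂ)
    (htop : X (m + 1) = v) (hX : ∀ i ≤ m, X i = r i (X (i + 1)) + J i) {Cb : ℝ} (hCb : 0 ≤ Cb)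
    (hv : ∀ i ≤ m + 1, Real.sqrt (dirSq (R i (m + 1) v) (F i)) ≤ Cb * (L : ℝ) ^ (m + 1 - i) * Real.sqrt (dirSq v (F (m + 1))))
    (hJ : ∀ i k : ℕ, i ≤ k → k ≤ m → Real.sqrt (dirSq (R i k (J k)) (F i)) ≤ Cb * (L : ℝ) ^ (k - i) * Real.sqrt (dirSq (J k) (F k))) :
    ∑ i ∈ range (m + 1), (((L : ℝ) ^ 3)⁻¹) ^ (m - i) * dirSq (X i) (F i)
      ≤ 4 * Cb ^ 2 * (L : ℝ) ^ 2 * dirSq v (F (m + 1)) + 8 * Cb ^ 2 * ∑ k ∈ range (m + 1), (((L : ℝ) ^ 2)⁻¹) ^ (m - k) * dirSq (J k) (F k) := by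
  have hL' : (2 : ℝ) ≤ L := by exact_mod_cast hL
  -- the level functionals
  set p : ℕ → (Site d → Fin d → Matrix n n ℂ) → ℝ := fun i Y => Real.sqrt (dirSq Y (F i)) with hp
  have hp0 : ∀ i, p i 0 = 0 := fun i => by simp only [hp]; rw [show (0 : Site d → Fin d → Matrix n n ℂ) = fun _ _ => 0 from rfl, dirSq_zero, Real.sqrt_zero]
  have hpadd : ∀ i (a b : Site d → Fin d → Matrix n n ℂ), p i (a + b) ≤ p i a + p i b := fun i a b => sqrt_dirSq_add_le a b (F i)
  have hmain := seminorm_tower_le p hp0 hpadd r R hRself hRleft m X J v htop hX (Cb := Cb) (ρ := (L : ℝ)) hv hJ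
  have hdir0 : ∀ (Y : Site d → Fin d → Matrix n n ℂ) (G : Finset (Site d)), 0 ≤ dirSq Y G := by
    intro Y G; unfold dirSq; positivity
  have hw := weighted_sq_sum_le hL' m hCb (Real.sqrt_nonneg (dirSq v (F (m + 1)))) (a := fun i => p i (X i)) (b := fun k => p k (J k))
    (fun i _ => Real.sqrt_nonneg _) (fun k _ => Real.sqrt_nonneg _) (fun i hi => hmain i (by omega))
  simp only [hp, Real.sq_sqrt (hdir0 _ _)] at hw
  exact hw

end

end Summit.QuantumFields.BalabanUV.T4Continuum.NE7LevelMassBudget
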